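import Mathlib.Analysis.SpecialFunctions.Pow.Real
import HarnessLib

/-!
# Fluid computer — the CLOCK side of the `√ν·Z` crossing test (Reynolds ladder R3 pass 2, RULING R40;
# idea-2's pre-registered P98 K1 "crossing clock"; pub-fluidc-lit gen 41)

HONEST FRAMING (cell `pub-fluidc`, verbatim): *low prior, high value-of-information experiment on Tao's
machine paradigm; NOT a claim that NS blows up.*  Theorem side of the cell; nothing here is evidence of
blow-up.  Pure real bookkeeping: no PDE object is used, 0 sorry, no definition, no named fact (D-0026).

WHAT IS READ.  One field is run at viscosities `ν_a > ν_b > ν_c > …` (rungs `ρ = ν₀/ν`); per PAIR of rungs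
idea-2's P98 (cell file `PREREG-NEG-REAXIS-G10.md` §2h, K1) reads the CROSSING TIME `t_x(a,b)` of the curves
`B_a = √ν_a·Z_a` and `B_b = √ν_b·Z_b` (the more viscous rung is above at small times and below later), the
words being FAN-OUT (`t_x` non-decreasing in each argument), KERR-COMMON (all pairwise `t_x` in one narrow
window — after R. M. Kerr, J. Fluid Mech. 839 (2018) R2, where `√ν Z_ν(t)` of trefoils / anti-parallel
tubes cross at one `ν`-independent `t_x`) and INVERTED FAN; cell LITERATURE.md §A22.23c records that the two
printed reconnection pictures (Kerr; Hussain–Duraisamy 2011) share the amplitude law and differ on this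
CLOCK only.  The companion leaf `EnstrophyCrossing` (gen 40) typed the AMPLITUDE-EXPONENT family; this leaf
types what constrains the clock words themselves:

* §1 MODEL-FREE SANDWICH.  If each ADJACENT pair `(a,b)`, `(b,c)` changes order exactly once on the window
  `W` (at `x_ab`, `x_bc`), then every time in `W` at which the SKIP pair `(a,c)` agrees lies in
  `[min(x_ab,x_bc), max(x_ab,x_bc)]` (`skip_crossing_sandwich`), strictly inside when the adjacent times
  differ (`skip_crossing_mem_Ioo`), and such a time EXISTS between them for continuous curves
  (`skip_crossing_exists`).  Consequences for the K1 table: FAN-OUT over a ladder is decided by the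
  adjacent pairs alone (`skip_crossing_mem_Icc`); equal adjacent crossing times force the skip crossing to
  the same instant (`skip_crossing_eq_of_eq` — KERR-COMMON transfers); an INVERTED skip pair needs an
  inverted adjacent pair (`skip_crossing_mem_Icc'`); for `n` rungs any end-to-end crossing is neither
  before all nor after all adjacent crossings (`endToEnd_crossing_not_before/_not_after`).  A K1 table
  violating these certifies that some pair does NOT cross exactly once on `W`.
* §2 THE READER'S CURRENCY.  idea-2's local Reynolds exponent `a(t) = log(Z_b/Z_a)/log(ν_a/ν_b)`
  (= `log(Z_b/Z_a)/log(ρ_b/ρ_a)`): the more viscous rung is above iff `a < 1/2`, the pair crosses iff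
  `a = 1/2` (`sqrt_mul_lt_iff_exponent`, `sqrt_mul_eq_iff_exponent`); the skip-pair exponent is the
  log-weighted MEDIANT of the adjacent exponents, hence between them (`exponent_skip_eq_mediant`,
  `exponent_skip_between`); a pair whose exponent increases strictly on `W` crosses at most once with
  exactly the sign pattern §1 assumes (`sign_pattern_of_exponent_strictMonoOn`).
* §3 (sibling leaf `CrossingDelay`) THE PURE-DELAY FAMILY `t ↦ Z(t − τ)` — the clock-shift mechanism in
  isolation: delayed copies of one unimodal template cross exactly once, STRICTLY BETWEEN THEIR PEAK
  TIMES, strictly fanned in the order of the delays, never KERR-COMMON.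

The companion AMPLITUDE-EXPONENT family is `EnstrophyCrossing` §3 (gen 40).  Neither family is asserted
to be any paper's model; they are the two pure mechanisms whose crossing signatures differ, typed so that
a rung line can say which one a measured K1 table is compatible with.
-/

noncomputable section

namespace Summit.NavierStokesRegularity.FluidComputer.CrossingLadder

open Set Real

/-! ## §1 Model-free: the skip-pair crossing is sandwiched by the adjacent-pair crossings -/

section Sandwich

variable {W : Set ℝ} {fa fb fc : ℝ → ℝ} {xab xbc s : ℝ}

/-! Conventions: `fa, fb, fc` are the `B`-curves of three rungs `a, b, c` in ladder order (`a` the most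
viscous); "the pair `(a,b)` changes order once on `W` at `xab`" is carried as the two hypotheses
`∀ t ∈ W, t < xab → fb t < fa t` and `∀ t ∈ W, xab < t → fa t < fb t` (nothing is assumed AT `xab`
unless stated). -/

/-- Before both adjacent crossing times the outer curves are strictly ordered: `c` below `a`. -/
theorem outer_lt_of_lt_adjacent (hab : ∀ t ∈ W, t < xab → fb t < fa t)
    (hbc : ∀ t ∈ W, t < xbc → fc t < fb t) {t : ℝ} (ht : t ∈ W) (h₁ : t < xab) (h₂ : t < xbc) :
    fc t < fa t :=
  (hbc t ht h₂).trans (hab t ht h₁)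

/-- After both adjacent crossing times the outer curves are strictly ordered the other way. -/
theorem outer_gt_of_gt_adjacent (hab : ∀ t ∈ W, xab < t → fa t < fb t)
    (hbc : ∀ t ∈ W, xbc < t → fb t < fc t) {t : ℝ} (ht : t ∈ W) (h₁ : xab < t) (h₂ : xbc < t) :
    fa t < fc t :=
  (hab t ht h₁).trans (hbc t ht h₂)

/-- **Sandwich (model-free).**  If the adjacent pairs `(a,b)` and `(b,c)` each change order exactly once
on `W`, at `xab` and `xbc`, then ANY time `s ∈ W` at which the skip pair agrees (`fa s = fc s`) satisfies
`min xab xbc ≤ s ≤ max xab xbc`. -/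
theorem skip_crossing_sandwich (hab₁ : ∀ t ∈ W, t < xab → fb t < fa t)
    (hab₂ : ∀ t ∈ W, xab < t → fa t < fb t) (hbc₁ : ∀ t ∈ W, t < xbc → fc t < fb t)
    (hbc₂ : ∀ t ∈ W, xbc < t → fb t < fc t) (hs : s ∈ W) (h : fa s = fc s) :
    min xab xbc ≤ s ∧ s ≤ max xab xbc := by
  constructor
  · by_contra hlt
    have hlt := not_le.mp hlt
    exact (outer_lt_of_lt_adjacent hab₁ hbc₁ hs (hlt.trans_le (min_le_left _ _))
      (hlt.trans_le (min_le_right _ _))).ne' h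
  · by_contra hlt
    have hlt := not_le.mp hlt
    exact (outer_gt_of_gt_adjacent hab₂ hbc₂ hs ((le_max_left _ _).trans_lt hlt)
      ((le_max_right _ _).trans_lt hlt)).ne h

/-- **FAN-OUT is decided by the adjacent pairs.**  If `xab ≤ xbc` then every skip crossing lies in
`[xab, xbc]`; in particular `t_x` is then automatically non-decreasing in EACH argument over the triple
(`xab ≤ s` and `s ≤ xbc`). -/
theorem skip_crossing_mem_Icc (hab₁ : ∀ t ∈ W, t < xab → fb t < fa t)
    (hab₂ : ∀ t ∈ W, xab < t → fa t < fb t) (hbc₁ : ∀ t ∈ W, t < xbc → fc t < fb t)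
    (hbc₂ : ∀ t ∈ W, xbc < t → fb t < fc t) (hle : xab ≤ xbc) (hs : s ∈ W) (h : fa s = fc s) :
    s ∈ Icc xab xbc := by
  obtain ⟨h₁, h₂⟩ := skip_crossing_sandwich hab₁ hab₂ hbc₁ hbc₂ hs h
  rw [min_eq_left hle] at h₁
  rw [max_eq_right hle] at h₂
  exact ⟨h₁, h₂⟩

/-- **An INVERTED skip pair needs an inverted adjacent pair.**  If `xbc ≤ xab` then every skip crossing
lies in `[xbc, xab]`; contrapositively a skip crossing earlier than BOTH adjacent ones is impossible. -/
theorem skip_crossing_mem_Icc' (hab₁ : ∀ t ∈ W, t < xab → fb t < fa t)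
    (hab₂ : ∀ t ∈ W, xab < t → fa t < fb t) (hbc₁ : ∀ t ∈ W, t < xbc → fc t < fb t)
    (hbc₂ : ∀ t ∈ W, xbc < t → fb t < fc t) (hle : xbc ≤ xab) (hs : s ∈ W) (h : fa s = fc s) :
    s ∈ Icc xbc xab := by
  obtain ⟨h₁, h₂⟩ := skip_crossing_sandwich hab₁ hab₂ hbc₁ hbc₂ hs h
  rw [min_eq_right hle] at h₁
  rw [max_eq_left hle] at h₂
  exact ⟨h₁, h₂⟩

/-- **KERR-COMMON transfers from the adjacent pairs.**  If the two adjacent crossing times coincide,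
every skip crossing in `W` happens at that same instant. -/
theorem skip_crossing_eq_of_eq (hab₁ : ∀ t ∈ W, t < xab → fb t < fa t)
    (hab₂ : ∀ t ∈ W, xab < t → fa t < fb t) (hbc₁ : ∀ t ∈ W, t < xbc → fc t < fb t)
    (hbc₂ : ∀ t ∈ W, xbc < t → fb t < fc t) (he : xab = xbc) (hs : s ∈ W) (h : fa s = fc s) :
    s = xab := by
  obtain ⟨h₁, h₂⟩ := skip_crossing_mem_Icc hab₁ hab₂ hbc₁ hbc₂ he.le hs h
  exact le_antisymm (he ▸ h₂) h₁

/-- **Strict sandwich.**  If moreover the adjacent crossings are genuine crossing points of `W`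
(`fa xab = fb xab`, `fb xbc = fc xbc`) with `xab < xbc`, every skip crossing lies STRICTLY between them. -/
theorem skip_crossing_mem_Ioo (hab₁ : ∀ t ∈ W, t < xab → fb t < fa t)
    (hab₂ : ∀ t ∈ W, xab < t → fa t < fb t) (hbc₁ : ∀ t ∈ W, t < xbc → fc t < fb t)
    (hbc₂ : ∀ t ∈ W, xbc < t → fb t < fc t) (hxab : xab ∈ W) (hxbc : xbc ∈ W)
    (hab : fa xab = fb xab) (hbc : fb xbc = fc xbc) (hlt : xab < xbc) (hs : s ∈ W)
    (h : fa s = fc s) : s ∈ Ioo xab xbc := by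
  obtain ⟨h₁, h₂⟩ := skip_crossing_mem_Icc hab₁ hab₂ hbc₁ hbc₂ hlt.le hs h
  refine ⟨lt_of_le_of_ne h₁ ?_, lt_of_le_of_ne h₂ ?_⟩
  · rintro rfl
    exact ((hbc₁ _ hxab hlt).trans_eq hab.symm).ne' h
  · rintro rfl
    exact ((hab₂ _ hxbc hlt).trans_eq hbc).ne h

/-- **Existence.**  Under the same data with `fa, fc` continuous on `[xab, xbc]`, the skip pair DOES
cross there: at `xab` the curve `a` (level with `b`) is still above `c`, at `xbc` it is below `c`
(level with `b`); intermediate value theorem. -/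
theorem skip_crossing_exists (hab₂ : ∀ t ∈ W, xab < t → fa t < fb t)
    (hbc₁ : ∀ t ∈ W, t < xbc → fc t < fb t) (hxab : xab ∈ W) (hxbc : xbc ∈ W)
    (hab : fa xab = fb xab) (hbc : fb xbc = fc xbc) (hlt : xab < xbc)
    (hfa : ContinuousOn fa (Icc xab xbc)) (hfc : ContinuousOn fc (Icc xab xbc)) :
    ∃ s ∈ Icc xab xbc, fa s = fc s := by
  have hg : ContinuousOn (fun t => fa t - fc t) (Icc xab xbc) := hfa.sub hfc
  have h1 : 0 ≤ fa xab - fc xab := by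
    rw [hab]
    exact (sub_pos.2 (hbc₁ _ hxab hlt)).le
  have h2 : fa xbc - fc xbc ≤ 0 := by
    rw [← hbc]
    exact (sub_neg.2 (hab₂ _ hxbc hlt)).le
  obtain ⟨s, hs, hs0⟩ := intermediate_value_Icc' hlt.le hg ⟨h2, h1⟩
  exact ⟨s, hs, sub_eq_zero.1 hs0⟩

/-- Existence and strict location together: a skip crossing exists in the OPEN interval. -/
theorem skip_crossing_exists_Ioo (hab₁ : ∀ t ∈ W, t < xab → fb t < fa t)
    (hab₂ : ∀ t ∈ W, xab < t → fa t < fb t) (hbc₁ : ∀ t ∈ W, t < xbc → fc t < fb t)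
    (hbc₂ : ∀ t ∈ W, xbc < t → fb t < fc t) (hxab : xab ∈ W) (hxbc : xbc ∈ W)
    (hW : Icc xab xbc ⊆ W) (hab : fa xab = fb xab) (hbc : fb xbc = fc xbc) (hlt : xab < xbc)
    (hfa : ContinuousOn fa (Icc xab xbc)) (hfc : ContinuousOn fc (Icc xab xbc)) :
    ∃ s ∈ Ioo xab xbc, fa s = fc s := by
  obtain ⟨s, hs, h⟩ := skip_crossing_exists hab₂ hbc₁ hxab hxbc hab hbc hlt hfa hfc
  exact ⟨s, skip_crossing_mem_Ioo hab₁ hab₂ hbc₁ hbc₂ hxab hxbc hab hbc hlt (hW hs) h, h⟩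

end Sandwich

/-! ### The same for a ladder of `n + 1` rungs (`f 0, …, f n`; adjacent crossing times `x 0, …, x (n-1)`) -/

section Chain

variable {f : ℕ → ℝ → ℝ} {x : ℕ → ℝ} {W : Set ℝ} {t s : ℝ} {n : ℕ}

/-- A strict telescoping chain at one instant: `f n t < … < f 1 t < f 0 t`. -/
theorem chain_lt : ∀ n : ℕ, 0 < n → (∀ i < n, f (i + 1) t < f i t) → f n t < f 0 t
  | 0, h, _ => (lt_irrefl 0 h).elim
  | 1, _, hs => hs 0 one_pos
  | n + 2, _, hs =>
      (hs (n + 1) (by omega)).trans (chain_lt (n + 1) n.succ_pos fun i hi => hs i (by omega))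

/-- The mirror chain: `f 0 t < f 1 t < … < f n t`. -/
theorem chain_gt : ∀ n : ℕ, 0 < n → (∀ i < n, f i t < f (i + 1) t) → f 0 t < f n t
  | 0, h, _ => (lt_irrefl 0 h).elim
  | 1, _, hs => hs 0 one_pos
  | n + 2, _, hs =>
      (chain_gt (n + 1) n.succ_pos fun i hi => hs i (by omega)).trans (hs (n + 1) (by omega))

/-- **End-to-end crossings are not before ALL adjacent crossings** (`n ≥ 1` steps, each adjacent pair
`(i, i+1)` ordered "`i+1` below `i`" before its crossing time `x i` on `W`). -/
theorem endToEnd_crossing_not_before (hn : 0 < n)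
    (h : ∀ i < n, ∀ t ∈ W, t < x i → f (i + 1) t < f i t) (hs : s ∈ W) (he : f 0 s = f n s) :
    ∃ i < n, x i ≤ s := by
  by_contra hne
  simp only [not_exists, not_and, not_le] at hne
  exact (chain_lt n hn fun i hi => h i hi s hs (hne i hi)).ne' he

/-- … and not after ALL adjacent crossings. -/
theorem endToEnd_crossing_not_after (hn : 0 < n)
    (h : ∀ i < n, ∀ t ∈ W, x i < t → f i t < f (i + 1) t) (hs : s ∈ W) (he : f 0 s = f n s) :
    ∃ i < n, s ≤ x i := by
  by_contra hne
  simp only [not_exists, not_and, not_le] at hne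
  exact (chain_gt n hn fun i hi => h i hi s hs (hne i hi)).ne he

end Chain

/-! ## §2 The reader's currency: idea-2's local Reynolds exponent `a = log(Z_b/Z_a) / log(ν_a/ν_b)` -/

section Exponent

variable {νa νb νc Za Zb Zc : ℝ}

/-- By construction the more viscous rung starts above: equal enstrophies, `ν_b < ν_a`. -/
theorem sqrt_mul_lt_sqrt_mul_of_eq {Z₀ : ℝ} (hνb : 0 ≤ νb) (hν : νb < νa) (hZ : 0 < Z₀) :
    sqrt νb * Z₀ < sqrt νa * Z₀ :=
  mul_lt_mul_of_pos_right (sqrt_lt_sqrt hνb hν) hZ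

/-- Crossing as a ratio statement: `√ν_a Z_a = √ν_b Z_b` iff `Z_b/Z_a = √(ν_a/ν_b)`. -/
theorem sqrt_mul_eq_iff_ratio (hνb : 0 < νb) (hZa : 0 < Za) :
    sqrt νa * Za = sqrt νb * Zb ↔ Zb / Za = sqrt (νa / νb) := by
  have hsb : 0 < sqrt νb := sqrt_pos.2 hνb
  rw [sqrt_div' νa hνb.le, div_eq_div_iff hZa.ne' hsb.ne']
  constructor
  · intro h
    rw [mul_comm Zb, ← h]
  · intro h
    rw [mul_comm (sqrt νb), h]

/-- "More viscous rung above" as a ratio statement: `√ν_b Z_b < √ν_a Z_a` iff `Z_b/Z_a < √(ν_a/ν_b)`. -/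
theorem sqrt_mul_lt_iff_ratio (hνb : 0 < νb) (hZa : 0 < Za) :
    sqrt νb * Zb < sqrt νa * Za ↔ Zb / Za < sqrt (νa / νb) := by
  have hsb : 0 < sqrt νb := sqrt_pos.2 hνb
  rw [sqrt_div' νa hνb.le, lt_div_iff₀ hsb, div_mul_eq_mul_div, div_lt_iff₀ hZa, mul_comm Zb]

/-- "Less viscous rung above": `√ν_a Z_a < √ν_b Z_b` iff `√(ν_a/ν_b) < Z_b/Z_a`. -/
theorem sqrt_mul_gt_iff_ratio (hνb : 0 < νb) (hZa : 0 < Za) :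
    sqrt νa * Za < sqrt νb * Zb ↔ sqrt (νa / νb) < Zb / Za := by
  have hsb : 0 < sqrt νb := sqrt_pos.2 hνb
  rw [sqrt_div' νa hνb.le, div_lt_iff₀ hsb, div_mul_eq_mul_div, lt_div_iff₀ hZa, mul_comm Zb]

/-- **Crossing iff the exponent is `1/2`.**  For `0 < ν_b < ν_a` and positive enstrophies:
`√ν_a Z_a = √ν_b Z_b` iff `log(Z_b/Z_a)/log(ν_a/ν_b) = 1/2` (idea-2: "`a(t_x) = ½` by definition"). -/
theorem sqrt_mul_eq_iff_exponent (hνb : 0 < νb) (hν : νb < νa) (hZa : 0 < Za) (hZb : 0 < Zb) :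
    sqrt νa * Za = sqrt νb * Zb ↔ log (Zb / Za) / log (νa / νb) = 1 / 2 := by
  have hνa : 0 < νa := hνb.trans hν
  have hq : 0 < νa / νb := div_pos hνa hνb
  have hw : 0 < log (νa / νb) := log_pos ((one_lt_div hνb).2 hν)
  have hr : 0 < Zb / Za := div_pos hZb hZa
  rw [sqrt_mul_eq_iff_ratio hνb hZa, ← log_injOn_pos.eq_iff hr (sqrt_pos.2 hq), log_sqrt hq.le,
    div_eq_iff hw.ne']
  constructor <;> intro h <;> linarith

/-- **The more viscous rung is above iff `a < 1/2`.** -/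
theorem sqrt_mul_lt_iff_exponent (hνb : 0 < νb) (hν : νb < νa) (hZa : 0 < Za) (hZb : 0 < Zb) :
    sqrt νb * Zb < sqrt νa * Za ↔ log (Zb / Za) / log (νa / νb) < 1 / 2 := by
  have hνa : 0 < νa := hνb.trans hν
  have hq : 0 < νa / νb := div_pos hνa hνb
  have hw : 0 < log (νa / νb) := log_pos ((one_lt_div hνb).2 hν)
  have hr : 0 < Zb / Za := div_pos hZb hZa
  rw [sqrt_mul_lt_iff_ratio hνb hZa, ← log_lt_log_iff hr (sqrt_pos.2 hq), log_sqrt hq.le,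
    div_lt_iff₀ hw]
  constructor <;> intro h <;> linarith

/-- **The less viscous rung is above iff `1/2 < a`.** -/
theorem sqrt_mul_gt_iff_exponent (hνb : 0 < νb) (hν : νb < νa) (hZa : 0 < Za) (hZb : 0 < Zb) :
    sqrt νa * Za < sqrt νb * Zb ↔ 1 / 2 < log (Zb / Za) / log (νa / νb) := by
  have hνa : 0 < νa := hνb.trans hν
  have hq : 0 < νa / νb := div_pos hνa hνb
  have hw : 0 < log (νa / νb) := log_pos ((one_lt_div hνb).2 hν)
  have hr : 0 < Zb / Za := div_pos hZb hZa
  rw [sqrt_mul_gt_iff_ratio hνb hZa, ← log_lt_log_iff (sqrt_pos.2 hq) hr, log_sqrt hq.le,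
    lt_div_iff₀ hw]
  constructor <;> intro h <;> linarith

/-- Log-ratios add along the ladder: `log(Z_c/Z_a) = log(Z_b/Z_a) + log(Z_c/Z_b)`. -/
theorem log_ratio_add (hZa : 0 < Za) (hZb : 0 < Zb) (hZc : 0 < Zc) :
    log (Zc / Za) = log (Zb / Za) + log (Zc / Zb) := by
  rw [log_div hZc.ne' hZa.ne', log_div hZb.ne' hZa.ne', log_div hZc.ne' hZb.ne']
  ring

/-- **The skip-pair exponent is the MEDIANT of the adjacent exponents** (weights `log(ν_a/ν_b)`,
`log(ν_b/ν_c)`): `a_ac = (log(Z_b/Z_a) + log(Z_c/Z_b)) / (log(ν_a/ν_b) + log(ν_b/ν_c))`. -/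
theorem exponent_skip_eq_mediant (hνa : 0 < νa) (hνb : 0 < νb) (hνc : 0 < νc) (hZa : 0 < Za)
    (hZb : 0 < Zb) (hZc : 0 < Zc) :
    log (Zc / Za) / log (νa / νc)
      = (log (Zb / Za) + log (Zc / Zb)) / (log (νa / νb) + log (νb / νc)) := by
  rw [← log_ratio_add hZa hZb hZc, log_ratio_add hνc hνb hνa, add_comm (log (νb / νc))]

/-! Mediant arithmetic (positive weights; the four one-line `iff`s are private helpers). -/

/-- `L₁/w₁ ≤ mediant` iff `L₁/w₁ ≤ L₂/w₂`. -/
private theorem div_le_mediant_iff {L₁ L₂ w₁ w₂ : ℝ} (hw₁ : 0 < w₁) (hw₂ : 0 < w₂) :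
    L₁ / w₁ ≤ (L₁ + L₂) / (w₁ + w₂) ↔ L₁ / w₁ ≤ L₂ / w₂ := by
  rw [div_le_div_iff₀ hw₁ (add_pos hw₁ hw₂), div_le_div_iff₀ hw₁ hw₂]
  constructor <;> intro h <;> linarith

/-- `mediant ≤ L₂/w₂` iff `L₁/w₁ ≤ L₂/w₂`. -/
private theorem mediant_le_div_iff {L₁ L₂ w₁ w₂ : ℝ} (hw₁ : 0 < w₁) (hw₂ : 0 < w₂) :
    (L₁ + L₂) / (w₁ + w₂) ≤ L₂ / w₂ ↔ L₁ / w₁ ≤ L₂ / w₂ := by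
  rw [div_le_div_iff₀ (add_pos hw₁ hw₂) hw₂, div_le_div_iff₀ hw₁ hw₂]
  constructor <;> intro h <;> linarith

/-- `mediant ≤ L₁/w₁` iff `L₂/w₂ ≤ L₁/w₁`. -/
private theorem mediant_le_div_iff' {L₁ L₂ w₁ w₂ : ℝ} (hw₁ : 0 < w₁) (hw₂ : 0 < w₂) :
    (L₁ + L₂) / (w₁ + w₂) ≤ L₁ / w₁ ↔ L₂ / w₂ ≤ L₁ / w₁ := by
  rw [div_le_div_iff₀ (add_pos hw₁ hw₂) hw₁, div_le_div_iff₀ hw₂ hw₁]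
  constructor <;> intro h <;> linarith

/-- `L₂/w₂ ≤ mediant` iff `L₂/w₂ ≤ L₁/w₁`. -/
private theorem div_le_mediant_iff' {L₁ L₂ w₁ w₂ : ℝ} (hw₁ : 0 < w₁) (hw₂ : 0 < w₂) :
    L₂ / w₂ ≤ (L₁ + L₂) / (w₁ + w₂) ↔ L₂ / w₂ ≤ L₁ / w₁ := by
  rw [div_le_div_iff₀ hw₂ (add_pos hw₁ hw₂), div_le_div_iff₀ hw₂ hw₁]
  constructor <;> intro h <;> linarith

/-- The mediant lies between the two fractions. -/
theorem mediant_between {L₁ L₂ w₁ w₂ : ℝ} (hw₁ : 0 < w₁) (hw₂ : 0 < w₂) :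
    min (L₁ / w₁) (L₂ / w₂) ≤ (L₁ + L₂) / (w₁ + w₂)
      ∧ (L₁ + L₂) / (w₁ + w₂) ≤ max (L₁ / w₁) (L₂ / w₂) := by
  rcases le_total (L₁ / w₁) (L₂ / w₂) with h | h
  · exact ⟨(min_le_left _ _).trans ((div_le_mediant_iff hw₁ hw₂).2 h),
      ((mediant_le_div_iff hw₁ hw₂).2 h).trans (le_max_right _ _)⟩
  · exact ⟨(min_le_right _ _).trans ((div_le_mediant_iff' hw₁ hw₂).2 h),
      ((mediant_le_div_iff' hw₁ hw₂).2 h).trans (le_max_left _ _)⟩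

/-- If both fractions equal `θ`, so does the mediant (KERR-COMMON at an instant: both adjacent exponents
`= 1/2` ⇒ the skip exponent `= 1/2`). -/
theorem mediant_eq_of_eq {L₁ L₂ w₁ w₂ θ : ℝ} (hw₁ : 0 < w₁) (hw₂ : 0 < w₂) (h₁ : L₁ / w₁ = θ)
    (h₂ : L₂ / w₂ = θ) : (L₁ + L₂) / (w₁ + w₂) = θ := by
  rw [div_eq_iff hw₁.ne'] at h₁
  rw [div_eq_iff hw₂.ne'] at h₂
  rw [div_eq_iff (add_pos hw₁ hw₂).ne', h₁, h₂]
  ring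

/-- If the mediant and one fraction equal `θ`, so does the other (a skip crossing simultaneous with one
adjacent crossing forces the other adjacent pair to cross at that instant too). -/
theorem eq_of_mediant_eq {L₁ L₂ w₁ w₂ θ : ℝ} (hw₁ : 0 < w₁) (hw₂ : 0 < w₂)
    (h : (L₁ + L₂) / (w₁ + w₂) = θ) (h₁ : L₁ / w₁ = θ) : L₂ / w₂ = θ := by
  rw [div_eq_iff hw₁.ne'] at h₁
  rw [div_eq_iff (add_pos hw₁ hw₂).ne'] at h
  rw [div_eq_iff hw₂.ne']
  linarith

/-- **The skip-pair exponent lies between the adjacent exponents** (`0 < ν_c < ν_b < ν_a`, positive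
enstrophies).  Hence `a_ac = 1/2` forces `min(a_ab, a_bc) ≤ 1/2 ≤ max(a_ab, a_bc)`: at a skip crossing
one adjacent pair has crossed (or is crossing) and the other has not (or is crossing) — the instant-wise
form of §1, with no single-crossing hypothesis. -/
theorem exponent_skip_between (hνc : 0 < νc) (hcb : νc < νb) (hba : νb < νa) (hZa : 0 < Za)
    (hZb : 0 < Zb) (hZc : 0 < Zc) :
    min (log (Zb / Za) / log (νa / νb)) (log (Zc / Zb) / log (νb / νc))
        ≤ log (Zc / Za) / log (νa / νc)
      ∧ log (Zc / Za) / log (νa / νc)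
        ≤ max (log (Zb / Za) / log (νa / νb)) (log (Zc / Zb) / log (νb / νc)) := by
  have hνb : 0 < νb := hνc.trans hcb
  have hνa : 0 < νa := hνb.trans hba
  rw [exponent_skip_eq_mediant hνa hνb hνc hZa hZb hZc]
  exact mediant_between (log_pos ((one_lt_div hνb).2 hba)) (log_pos ((one_lt_div hνc).2 hcb))

/-- Instant-wise KERR-COMMON in exponent currency: both adjacent exponents `= 1/2` ⇒ skip exponent
`= 1/2`. -/
theorem exponent_skip_eq_half (hνc : 0 < νc) (hcb : νc < νb) (hba : νb < νa) (hZa : 0 < Za)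
    (hZb : 0 < Zb) (hZc : 0 < Zc) (hab : log (Zb / Za) / log (νa / νb) = 1 / 2)
    (hbc : log (Zc / Zb) / log (νb / νc) = 1 / 2) : log (Zc / Za) / log (νa / νc) = 1 / 2 := by
  have hνb : 0 < νb := hνc.trans hcb
  have hνa : 0 < νa := hνb.trans hba
  rw [exponent_skip_eq_mediant hνa hνb hνc hZa hZb hZc]
  exact mediant_eq_of_eq (log_pos ((one_lt_div hνb).2 hba)) (log_pos ((one_lt_div hνc).2 hcb)) hab hbc

/-- **A monotonically saturating pair crosses exactly once, with §1's sign pattern.**  If the exponent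
`t ↦ log(Z_b t/Z_a t)/log(ν_a/ν_b)` is strictly increasing on `W` (`0 < ν_b < ν_a`, positive
enstrophies on `W`) and the pair crosses at `x ∈ W`, then the more viscous rung is above at every
earlier time of `W` and below at every later one. -/
theorem sign_pattern_of_exponent_strictMonoOn {Zat Zbt : ℝ → ℝ} {W : Set ℝ} {x : ℝ} (hνb : 0 < νb)
    (hν : νb < νa) (hZa : ∀ t ∈ W, 0 < Zat t) (hZb : ∀ t ∈ W, 0 < Zbt t)
    (hmono : StrictMonoOn (fun t => log (Zbt t / Zat t) / log (νa / νb)) W) (hx : x ∈ W)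
    (hcross : sqrt νa * Zat x = sqrt νb * Zbt x) :
    (∀ t ∈ W, t < x → sqrt νb * Zbt t < sqrt νa * Zat t)
      ∧ (∀ t ∈ W, x < t → sqrt νa * Zat t < sqrt νb * Zbt t) := by
  have hx' : log (Zbt x / Zat x) / log (νa / νb) = 1 / 2 :=
    (sqrt_mul_eq_iff_exponent hνb hν (hZa x hx) (hZb x hx)).1 hcross
  constructor
  · intro t ht htx
    rw [sqrt_mul_lt_iff_exponent hνb hν (hZa t ht) (hZb t ht), ← hx']
    exact hmono ht hx htx
  · intro t ht hxt
    rw [sqrt_mul_gt_iff_exponent hνb hν (hZa t ht) (hZb t ht), ← hx']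
    exact hmono hx ht hxt

end Exponent

end Summit.NavierStokesRegularity.FluidComputer.CrossingLadder

end
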